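import Summits.KontsevichZagierPeriods.KontsevichZagierPeriods.Theorems.UnfoldedStokesStokesGenerationStubRungDlogValue
import Mathlib.Analysis.SpecialFunctions.Log.Deriv
import Mathlib.MeasureTheory.Integral.IntervalIntegral.FundThmCalculus

/-!
# `StokesGeneration` (stmt-3586), line `fibrewise_stokes`, rung stub X2 (rung 10) — value of a semialgebraic exact-plus-dlog representation

The registered stub `stub_saDlogValue` of the line `Cruxes/StokesGeneration/Lines/fibrewise_stokes.lean`
(dlog sector of the residual, rung 10, redone for positive `C¹` functions instead of polynomials):
if `t` is an integral representation on the closed unit cube of `ℝ¹ = (Fin 1 → ℝ)` whose integrand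
agrees on the cube with `z ↦ g₀ (z 0) + Σᵢ cᵢ fᵢ′(z 0)/fᵢ(z 0)`, where `G₀′ = g₀` on `[0,1]` (`g₀`
continuous on `[0,1]`), every `fᵢ` is positive and continuous on `[0,1]` with derivative `fᵢ′` on
`(0,1)` and `fᵢ′` continuous on `[0,1]`, then
`t.value = (G₀ 1 − G₀ 0) + Σᵢ cᵢ log(fᵢ(1)/fᵢ(0))`.
Proof: transport the set integral over the cube of `ℝ¹` to `∫ y in Icc 0 1` (the landed helper
`setIntegral_cubePi_one_eq` of the sibling stub R1), pass to the interval integral, split the sum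
(every summand is continuous on `[0,1]`), and evaluate both pieces by FTC-2:
`∫₀¹ g₀ = G₀ 1 − G₀ 0` (landed helper `intervalIntegral_exactPart_eq_sub` of stub R6) and
`∫₀¹ fᵢ′/fᵢ = log fᵢ(1) − log fᵢ(0) = log(fᵢ(1)/fᵢ(0))` by
`intervalIntegral.integral_eq_sub_of_hasDerivAt_of_le` for `log ∘ fᵢ` (continuous on `[0,1]`,
derivative `fᵢ′/fᵢ` on `(0,1)` since `fᵢ > 0`).
[Kontsevich–Zagier 2001, §1.1]
-/

noncomputable section

set_option linter.dupNamespace false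

namespace Summit.KontsevichZagierPeriods.KontsevichZagierPeriods.Cruxes.StokesGeneration.FibrewiseStokes

open MeasureTheory Set
open Literature.NumberTheory.Transcendental
open Literature.NumberTheory.Transcendental.KZ

/-- The logarithmic derivative `f′/f` of a function `f` positive and continuous on `[0,1]`, with `f′`
continuous on `[0,1]`, is continuous on `uIcc 0 1 = [0,1]`. [folklore] -/
theorem continuousOn_logDeriv_fun {f f' : ℝ → ℝ} (hpos : ∀ u ∈ Set.Icc (0:ℝ) 1, 0 < f u)
    (hf : ContinuousOn f (Set.Icc (0:ℝ) 1)) (hf' : ContinuousOn f' (Set.Icc (0:ℝ) 1)) :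
    ContinuousOn (fun u : ℝ => f' u / f u) (Set.uIcc (0:ℝ) 1) := by
  rw [Set.uIcc_of_le zero_le_one]
  exact hf'.div hf (fun u hu => (hpos u hu).ne')

/-- Each dlog summand `u ↦ c · f′(u)/f(u)` (`f > 0` and `f, f′` continuous on `[0,1]`) is interval
integrable on `0..1` (it is continuous on `[0,1]`). [folklore] -/
theorem intervalIntegrable_const_mul_logDeriv_fun (c : ℝ) {f f' : ℝ → ℝ}
    (hpos : ∀ u ∈ Set.Icc (0:ℝ) 1, 0 < f u) (hf : ContinuousOn f (Set.Icc (0:ℝ) 1))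
    (hf' : ContinuousOn f' (Set.Icc (0:ℝ) 1)) :
    IntervalIntegrable (fun u : ℝ => c * (f' u / f u)) volume 0 1 :=
  (continuousOn_const.mul (continuousOn_logDeriv_fun hpos hf hf')).intervalIntegrable

/-- **The elementary dlog integral** for a positive `C¹` function: if `f > 0` and `f` is continuous on
`[0,1]`, `f′` is continuous on `[0,1]` and `f` has derivative `f′ u` at every `u ∈ (0,1)`, then
`∫₀¹ c · f′(u)/f(u) du = c · log(f(1)/f(0))` (FTC-2 on `[0,1]` with interior derivative for `log ∘ f`,
whose derivative on `(0,1)` is `f′/f` because `f ≠ 0` there, then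
`log f(1) − log f(0) = log(f(1)/f(0))`). [folklore] -/
theorem intervalIntegral_const_mul_logDeriv_fun (c : ℝ) {f f' : ℝ → ℝ}
    (hpos : ∀ u ∈ Set.Icc (0:ℝ) 1, 0 < f u) (hf : ContinuousOn f (Set.Icc (0:ℝ) 1))
    (hf' : ContinuousOn f' (Set.Icc (0:ℝ) 1))
    (hderiv : ∀ u ∈ Set.Ioo (0:ℝ) 1, HasDerivAt f (f' u) u) :
    ∫ u in (0:ℝ)..1, c * (f' u / f u) = c * Real.log (f 1 / f 0) := by
  have h1 : 0 < f 1 := hpos 1 ⟨zero_le_one, le_rfl⟩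
  have h0 : 0 < f 0 := hpos 0 ⟨le_rfl, zero_le_one⟩
  have hlogcont : ContinuousOn (fun y : ℝ => Real.log (f y)) (Set.Icc (0:ℝ) 1) :=
    hf.log (fun u hu => (hpos u hu).ne')
  have hlogderiv : ∀ u ∈ Set.Ioo (0:ℝ) 1,
      HasDerivAt (fun y : ℝ => Real.log (f y)) (f' u / f u) u := by
    intro u hu
    exact (hderiv u hu).log (hpos u (Set.Ioo_subset_Icc_self hu)).ne'
  rw [intervalIntegral.integral_const_mul, Real.log_div h1.ne' h0.ne',
    intervalIntegral.integral_eq_sub_of_hasDerivAt_of_le zero_le_one hlogcont hlogderiv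
      (continuousOn_logDeriv_fun hpos hf hf').intervalIntegrable]

/-- STUB X2 (rung 10, dlog sector) **value of a semialgebraic exact-plus-dlog representation**: for
positive `fᵢ` continuous on `[0,1]` with derivative `fᵢ′` on `(0,1)` (`fᵢ′` continuous on `[0,1]`)
and `G₀′ = g₀` on `[0,1]` (`g₀` continuous on `[0,1]`), a representation `t : IntegralRep 1` on the
closed unit cube of `ℝ¹` whose integrand agrees there with `z ↦ g₀ (z 0) + Σᵢ cᵢ fᵢ′(z 0)/fᵢ(z 0)` has
`t.value = (G₀ 1 − G₀ 0) + Σᵢ cᵢ log(fᵢ(1)/fᵢ(0))`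
(transport `ℝ¹ → ℝ`, then FTC-2 for `G₀` and for `log ∘ fᵢ`). [cite: KontsevichZagier2001, §1.1] -/
theorem stub_saDlogValue :
    ∀ (s : ℕ) (f f' : Fin s → ℝ → ℝ) (c : Fin s → ℝ) (G₀ g₀ : ℝ → ℝ),
      (∀ i, ∀ u ∈ Set.Icc (0:ℝ) 1, 0 < f i u) → (∀ i, ContinuousOn (f i) (Set.Icc (0:ℝ) 1)) →
      (∀ i, ContinuousOn (f' i) (Set.Icc (0:ℝ) 1)) → (∀ i, ∀ u ∈ Set.Ioo (0:ℝ) 1, HasDerivAt (f i) (f' i u) u) →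
      (∀ u ∈ Set.Icc (0:ℝ) 1, HasDerivAt G₀ (g₀ u) u) → ContinuousOn g₀ (Set.Icc (0:ℝ) 1) →
      ∀ (t : IntegralRep 1), t.domain = Set.pi Set.univ (fun _ : Fin 1 => Set.Icc (0:ℝ) 1) →
      (∀ z ∈ Set.pi Set.univ (fun _ : Fin 1 => Set.Icc (0:ℝ) 1), t.integrand z =
        g₀ (z 0) + ∑ i, c i * (f' i (z 0) / f i (z 0))) →
      t.value = (G₀ 1 - G₀ 0) + ∑ i, c i * Real.log (f i 1 / f i 0) := by
  intro s f f' c G₀ g₀ hpos hf hf' hderiv hG hg t ht hti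
  have hmeas : MeasurableSet (Set.pi Set.univ (fun _ : Fin 1 => Set.Icc (0:ℝ) 1)) :=
    MeasurableSet.univ_pi fun _ => measurableSet_Icc
  have hg_int : IntervalIntegrable g₀ volume 0 1 := by
    refine ContinuousOn.intervalIntegrable ?_
    rw [Set.uIcc_of_le zero_le_one]
    exact hg
  have hsum_int : IntervalIntegrable
      (fun u : ℝ => ∑ i, c i * (f' i u / f i u)) volume 0 1 :=
    (continuousOn_finsetSum Finset.univ fun i _ =>
      continuousOn_const.mul (continuousOn_logDeriv_fun (hpos i) (hf i) (hf' i))).intervalIntegrable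
  rw [IntegralRep.value, ht, setIntegral_congr_fun hmeas hti,
    setIntegral_cubePi_one_eq (fun y => g₀ y + ∑ i, c i * (f' i y / f i y)),
    integral_Icc_eq_integral_Ioc, ← intervalIntegral.integral_of_le zero_le_one,
    intervalIntegral.integral_add hg_int hsum_int,
    intervalIntegral.integral_finsetSum (s := Finset.univ)
      (fun i _ => intervalIntegrable_const_mul_logDeriv_fun (c i) (hpos i) (hf i) (hf' i)),
    intervalIntegral_exactPart_eq_sub hG hg]
  congr 1
  exact Finset.sum_congr rfl fun i _ =>
    intervalIntegral_const_mul_logDeriv_fun (c i) (hpos i) (hf i) (hf' i) (hderiv i)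

end Summit.KontsevichZagierPeriods.KontsevichZagierPeriods.Cruxes.StokesGeneration.FibrewiseStokes

end
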